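import Mathlib
import HarnessLib
import Summits.AtomisticToContinuum.Crystallization.Theses.TwoCentreKissingKernel

/-!
# Birth skeleton — crux `TwoCentreKissingKernel.TwoCentreFourCommon` (item stmt-AtomisticToContinuum-12077)

Line `birth` (skeleton-register, planner one-shot, 2026-08-17).  The crux (verbatim, route file
`Theses/TwoCentreKissingKernel.lean`) is Flatley–Theil's Conjecture 2.2 (arXiv:1407.0692, §2.1):

  `∀ Z ⊂ ℝ³` with pairwise distances `≥ 1`, `∀ z z' ∈ Z` with `dist z z' = 1`,
  `#N(z) = #N(z') = 12 → #(N(z) ∩ N(z')) ≥ 4`,   `N(z) = {w ∈ Z | dist w z = 1}`.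

Write `c = #(N(z) ∩ N(z'))` (the number of COMMON neighbours of the touching twelve-kissed pair;
`c ≤ 5` always, `c = 4` at every bond of FCC and HCP).

## The cut: GAP ▸ ONE-SPHERE POLAR CODE (`c ≥ 3`) ▸ COUPLED CORE (`c ≠ 3`)

* `stub_twelveKissedGap` — THE SEPARATION GAP OF A TWELVE-KISSED BALL (Hales 2012, Lemma 2 made
  local = Flyspeck `L12`; Böröczky–Szabó 2015, Theorem 3, Flyspeck-free in print), in the crux's
  units (touching centres at distance `1`): in a `1`-separated `Z`, a point `u` with exactly twelve
  points at distance `1` has every other point of `Z` at distance `1` or `≥ 63/50 = 1.26` (`= 2h₀/2`).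
  It is what replaces Flatley–Theil's three-body potential `V₃` / Hales's class `𝒱` hypothesis:
  the gap is PROVED from twelve-kissedness instead of being assumed.
* `stub_polarThree` — THE ONE-SPHERE LEMMA (a Tammes-type spherical-code statement, certificate
  technology: cap-packing / Delsarte–SDP with a distinguished point / interval branch-and-bound):
  twelve unit vectors with pairwise inner products `≤ 1/2` (angles `≥ 60°`), one of them a POLE `e`
  such that every other vector has inner product with `e` equal to `1/2` (a contact of the pole,
  angle `60°`) or `≤ 1031/5000 = 1 − (63/50)²/2` (angle `≥ 78.1°`), has AT LEAST THREE contacts of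
  the pole.  (Refuter pilots on the item: `c = 0, 1, 2` infeasible by `3.3°, 2.6°, 0.63°`; `c = 3`
  FEASIBLE with slack `0.22°–0.76°` — so three is exactly the reach of the one-sphere method; this
  session's kit job j022213, 250-start SLSQP: `c = 0, 1, 2` best max-min angle `56.74°, 57.62°, 59.42°`
  (short of `60°` by `3.26°, 2.38°, 0.58°`), `c = 3` attains `60°`.  The `c = 2` margin is thin: the
  fallback reshaping is `2 ≤ #contacts` here and `c ∉ {2, 3}` in the core, same assembly.)
* `stub_noThreeCommon` — THE COUPLED CORE: under the crux's hypotheses AND the two gap dichotomies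
  (every point of `Z` is at distance `1` or `≥ 63/50` from `z`, and likewise from `z'`), `c ≠ 3`.
  This is the genuinely two-centre statement (the case the one-sphere reduction cannot decide:
  coupled maximin searches reach min distance `0.9797` at `c = 3`, deficit `2.0 %`, extremiser an
  isolated `C₂`-symmetric KKT point), to be settled by a coupled two-sphere certificate
  (distinguished-point SDP on both spheres, or interval branch-and-bound over the `≤ 21` free balls).

`TwoCentreFourCommon_of_stubs` (sorry-free, hypothesis form; `TwoCentreFourCommon_of : TwoCentreFourCommon`
plugs the three stubs in by name) composes them: the gap stub yields both dichotomies; the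
shell `N(z)`, translated by `−z`, is a twelve-point unit-vector configuration containing the pole
`e = z' − z`; chord-to-cosine conversion (`⟪a, b⟫ = 1 − dist(a,b)²/2` for unit vectors) turns
`1`-separation into `⟪·,·⟫ ≤ 1/2`, contacts of `z'` into `⟪·, e⟫ = 1/2` and the gap at `z'` into
`⟪·, e⟫ ≤ 1031/5000`; the polar stub gives `≥ 3` pole contacts, which are transported back
(injectivity of translation, `Set.ncard` of an image) to `3 ≤ c`; the core stub gives `c ≠ 3`;
hence `4 ≤ c`.  All three stubs are load-bearing (`≠ 3` in the core keeps the one-sphere content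
out of it; the gap feeds both the polar hypothesis and the core's extra hypotheses).
-/

noncomputable section

namespace Summit.AtomisticToContinuum.Crystallization.Cruxes.TwoCentreFourCommon.Birth

open Summit.AtomisticToContinuum.Crystallization.Theses.TwoCentreKissingKernel

local notation "E3" => EuclideanSpace ℝ (Fin 3)

/-! ## Registered stubs -/

/-- **Stub 1 — the separation gap of a twelve-kissed ball** (Hales 2012, Lemma 2, local form;
Flyspeck `L12`; Böröczky–Szabó 2015, Theorem 3), crux units: if `Z ⊂ ℝ³` is `1`-separated and
`u ∈ Z` has exactly twelve points of `Z` at distance `1`, then every other point of `Z` not at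
distance `1` from `u` is at distance `≥ 63/50 = 1.26` from `u`. -/
theorem stub_twelveKissedGap :
    ∀ Z : Set (EuclideanSpace ℝ (Fin 3)), (∀ x ∈ Z, ∀ y ∈ Z, x ≠ y → 1 ≤ dist x y) →
      ∀ u ∈ Z, {w ∈ Z | dist w u = 1}.ncard = 12 →
        ∀ v ∈ Z, v ≠ u → dist v u ≠ 1 → (63 / 50 : ℝ) ≤ dist v u := by
  sorry

/-- **Stub 2 — the one-sphere polar-code lemma (`c ≥ 3`).**  Twelve unit vectors of `ℝ³` with
pairwise inner products `≤ 1/2`, among them a pole `e` such that every other one has inner product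
with `e` either `= 1/2` (a contact of the pole) or `≤ 1031/5000` (the gap, angle `≥ 78.1°`): then
the pole has at least three contacts. -/
theorem stub_polarThree :
    ∀ (X : Finset (EuclideanSpace ℝ (Fin 3))) (e : EuclideanSpace ℝ (Fin 3)), X.card = 12 →
      (∀ y ∈ X, ‖y‖ = 1) → (∀ y ∈ X, ∀ y' ∈ X, y ≠ y' → inner ℝ y y' ≤ (1 / 2 : ℝ)) → e ∈ X →
      (∀ y ∈ X, y ≠ e → inner ℝ y e = (1 / 2 : ℝ) ∨ inner ℝ y e ≤ (1031 / 5000 : ℝ)) →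
      3 ≤ (X.filter fun y => inner ℝ y e = (1 / 2 : ℝ)).card := by
  sorry

/-- **Stub 3 — the coupled core (`c ≠ 3`).**  Under the hypotheses of the crux and the two gap
dichotomies at `z` and at `z'` (every point of `Z` other than the centre is at distance `1` or
`≥ 63/50` from it), the touching twelve-kissed pair `z, z'` does not have exactly three common
neighbours. -/
theorem stub_noThreeCommon :
    ∀ Z : Set (EuclideanSpace ℝ (Fin 3)), (∀ x ∈ Z, ∀ y ∈ Z, x ≠ y → 1 ≤ dist x y) →
      ∀ z ∈ Z, ∀ z' ∈ Z, dist z z' = 1 →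
        {w ∈ Z | dist w z = 1}.ncard = 12 → {w ∈ Z | dist w z' = 1}.ncard = 12 →
        (∀ w ∈ Z, w ≠ z → dist w z = 1 ∨ (63 / 50 : ℝ) ≤ dist w z) →
        (∀ w ∈ Z, w ≠ z' → dist w z' = 1 ∨ (63 / 50 : ℝ) ≤ dist w z') →
        {w ∈ Z | dist w z = 1 ∧ dist w z' = 1}.ncard ≠ 3 := by
  sorry

/-! ## Assembly (no `sorry` below this line) -/

/-- Chord-to-cosine for unit vectors: `⟪a, b⟫ = 1 − dist(a, b)² / 2`. -/
theorem inner_eq_one_sub_dist_sq {a b : E3} (ha : ‖a‖ = 1) (hb : ‖b‖ = 1) :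
    inner ℝ a b = 1 - dist a b ^ 2 / 2 := by
  have h := norm_sub_sq_real a b
  rw [ha, hb, ← dist_eq_norm] at h
  norm_num at h
  linarith

/-- `1`-separated unit vectors have inner product `≤ 1/2`. -/
theorem inner_le_half_of_one_le_dist {a b : E3} (ha : ‖a‖ = 1) (hb : ‖b‖ = 1)
    (h : 1 ≤ dist a b) : inner ℝ a b ≤ (1 / 2 : ℝ) := by
  rw [inner_eq_one_sub_dist_sq ha hb]
  nlinarith [h]

/-- Unit vectors at distance exactly `1` have inner product `1/2`. -/
theorem inner_eq_half_of_dist_eq_one {a b : E3} (ha : ‖a‖ = 1) (hb : ‖b‖ = 1)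
    (h : dist a b = 1) : inner ℝ a b = (1 / 2 : ℝ) := by
  rw [inner_eq_one_sub_dist_sq ha hb, h]
  norm_num

/-- Unit vectors with inner product `1/2` are at distance exactly `1`. -/
theorem dist_eq_one_of_inner_eq_half {a b : E3} (ha : ‖a‖ = 1) (hb : ‖b‖ = 1)
    (h : inner ℝ a b = (1 / 2 : ℝ)) : dist a b = 1 := by
  rw [inner_eq_one_sub_dist_sq ha hb] at h
  have h2 : dist a b ^ 2 = 1 := by linarith
  have h0 : 0 ≤ dist a b := dist_nonneg
  nlinarith [h2, h0]

/-- The gap `63/50` in cosine form: unit vectors at distance `≥ 63/50` have inner product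
`≤ 1 − (63/50)²/2 = 1031/5000`. -/
theorem inner_le_of_gap_le_dist {a b : E3} (ha : ‖a‖ = 1) (hb : ‖b‖ = 1)
    (h : (63 / 50 : ℝ) ≤ dist a b) : inner ℝ a b ≤ (1031 / 5000 : ℝ) := by
  rw [inner_eq_one_sub_dist_sq ha hb]
  nlinarith [h]

/-- **The one-sphere reduction.**  From the polar-code lemma (as a hypothesis) and the gap
dichotomy at `z'`: the touching twelve-kissed pair has at least three common neighbours.  The shell
of `z`, translated by `−z`, is a twelve-point unit-vector configuration with pole `e = z' − z`;
`1`-separation becomes `⟪·,·⟫ ≤ 1/2`, contacts of `z'` become `⟪·, e⟫ = 1/2`, the gap at `z'` becomes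
`⟪·, e⟫ ≤ 1031/5000`, and the pole contacts are transported back to common neighbours. -/
theorem three_le_ncard_common
    (hpolar : ∀ (X : Finset (EuclideanSpace ℝ (Fin 3))) (e : EuclideanSpace ℝ (Fin 3)),
      X.card = 12 → (∀ y ∈ X, ‖y‖ = 1) →
      (∀ y ∈ X, ∀ y' ∈ X, y ≠ y' → inner ℝ y y' ≤ (1 / 2 : ℝ)) → e ∈ X →
      (∀ y ∈ X, y ≠ e → inner ℝ y e = (1 / 2 : ℝ) ∨ inner ℝ y e ≤ (1031 / 5000 : ℝ)) →
      3 ≤ (X.filter fun y => inner ℝ y e = (1 / 2 : ℝ)).card)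
    {Z : Set E3} (hZ : ∀ x ∈ Z, ∀ y ∈ Z, x ≠ y → 1 ≤ dist x y)
    {z z' : E3} (hz' : z' ∈ Z) (hzz' : dist z z' = 1)
    (hNz : {w ∈ Z | dist w z = 1}.ncard = 12)
    (hGz' : ∀ w ∈ Z, w ≠ z' → dist w z' = 1 ∨ (63 / 50 : ℝ) ≤ dist w z') :
    3 ≤ {w ∈ Z | dist w z = 1 ∧ dist w z' = 1}.ncard := by
  classical
  have hfin : {w ∈ Z | dist w z = 1}.Finite :=
    Set.finite_of_ncard_ne_zero (by rw [hNz]; norm_num)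
  have hinj : Function.Injective (fun w : E3 => w - z) := sub_left_injective
  -- the translated shell `X = N(z) − z` and the pole `e = z' − z`
  set X : Finset E3 := hfin.toFinset.image (fun w => w - z) with hX
  have memX_intro : ∀ w, w ∈ Z → dist w z = 1 → w - z ∈ X := fun w hw hd =>
    Finset.mem_image.2 ⟨w, hfin.mem_toFinset.2 ⟨hw, hd⟩, rfl⟩
  have memX_elim : ∀ y ∈ X, ∃ w, w ∈ Z ∧ dist w z = 1 ∧ w - z = y := by
    intro y hy
    obtain ⟨w, hw, rfl⟩ := Finset.mem_image.1 hy
    have hw' := hfin.mem_toFinset.1 hw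
    exact ⟨w, hw'.1, hw'.2, rfl⟩
  have hXcard : X.card = 12 := by
    rw [hX, Finset.card_image_of_injective _ hinj, ← Set.ncard_eq_toFinset_card _ hfin]
    exact hNz
  set e : E3 := z' - z with he
  have he1 : ‖e‖ = 1 := by
    rw [he, ← dist_eq_norm, dist_comm]
    exact hzz'
  have heX : e ∈ X := memX_intro z' hz' (by rw [dist_comm]; exact hzz')
  have hX1 : ∀ y ∈ X, ‖y‖ = 1 := by
    intro y hy
    obtain ⟨w, -, hd, rfl⟩ := memX_elim y hy
    rw [← dist_eq_norm]
    exact hd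
  have hXsep : ∀ y ∈ X, ∀ y' ∈ X, y ≠ y' → inner ℝ y y' ≤ (1 / 2 : ℝ) := by
    intro y hy y' hy' hne
    have hy1 := hX1 y hy
    have hy1' := hX1 y' hy'
    obtain ⟨w, hw, -, rfl⟩ := memX_elim y hy
    obtain ⟨w', hw', -, rfl⟩ := memX_elim y' hy'
    have hww : w ≠ w' := fun h => hne (by rw [h])
    have h1 : 1 ≤ dist (w - z) (w' - z) := by
      rw [dist_sub_right]
      exact hZ w hw w' hw' hww
    exact inner_le_half_of_one_le_dist hy1 hy1' h1
  have hXpol : ∀ y ∈ X, y ≠ e → inner ℝ y e = (1 / 2 : ℝ) ∨ inner ℝ y e ≤ (1031 / 5000 : ℝ) := by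
    intro y hy hne
    have hy1 := hX1 y hy
    obtain ⟨w, hw, -, rfl⟩ := memX_elim y hy
    have hwz' : w ≠ z' := fun h => hne (by rw [h, he])
    have hde : dist (w - z) e = dist w z' := by rw [he, dist_sub_right]
    rcases hGz' w hw hwz' with h | h
    · exact Or.inl (inner_eq_half_of_dist_eq_one hy1 he1 (by rw [hde]; exact h))
    · exact Or.inr (inner_le_of_gap_le_dist hy1 he1 (by rw [hde]; exact h))
  -- the polar-code lemma on the translated shell
  have h3 := hpolar X e hXcard hX1 hXsep heX hXpol
  -- transport the pole contacts back to the common neighbours of `z` and `z'`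
  have hset : (↑(X.filter fun y => inner ℝ y e = (1 / 2 : ℝ)) : Set E3) =
      (fun w : E3 => w - z) '' {w ∈ Z | dist w z = 1 ∧ dist w z' = 1} := by
    ext y
    simp only [Finset.coe_filter, Set.mem_setOf_eq, Set.mem_image]
    constructor
    · rintro ⟨hy, hinner⟩
      have hy1 := hX1 y hy
      obtain ⟨w, hw, hd, rfl⟩ := memX_elim y hy
      refine ⟨w, ⟨hw, hd, ?_⟩, rfl⟩
      have h1 := dist_eq_one_of_inner_eq_half hy1 he1 hinner
      rwa [he, dist_sub_right] at h1
    · rintro ⟨w, ⟨hw, hd, hd'⟩, rfl⟩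
      have hmem := memX_intro w hw hd
      refine ⟨hmem, ?_⟩
      exact inner_eq_half_of_dist_eq_one (hX1 _ hmem) he1 (by rw [he, dist_sub_right]; exact hd')
  have hcount : (X.filter fun y => inner ℝ y e = (1 / 2 : ℝ)).card =
      {w ∈ Z | dist w z = 1 ∧ dist w z' = 1}.ncard := by
    rw [← Set.ncard_coe_finset, hset, Set.ncard_image_of_injective _ hinj]
  rw [← hcount]
  exact h3

/-- **Composition over the stub STATEMENTS** (hypothesis form, sorry-free, standard axioms):
`⟨stub_twelveKissedGap⟩ → ⟨stub_polarThree⟩ → ⟨stub_noThreeCommon⟩ → ⟨the crux, written out verbatim⟩`.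
The gap stub yields the two gap dichotomies at `z` and `z'`; the one-sphere reduction
(`three_le_ncard_common`) gives `3 ≤ c`; the coupled core gives `c ≠ 3`; hence `4 ≤ c`.
(Conclusion written out rather than by name, so that `TwoCentreFourCommon_of` below is the
unique declaration of this file concluding the route decl; the `example` after it records the
shape `⟨stub₁⟩ → ⟨stub₂⟩ → ⟨stub₃⟩ → TwoCentreFourCommon` by `rfl`-unfolding.) -/
theorem TwoCentreFourCommon_of_stubs :
    (∀ Z : Set (EuclideanSpace ℝ (Fin 3)), (∀ x ∈ Z, ∀ y ∈ Z, x ≠ y → 1 ≤ dist x y) →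
      ∀ u ∈ Z, {w ∈ Z | dist w u = 1}.ncard = 12 →
        ∀ v ∈ Z, v ≠ u → dist v u ≠ 1 → (63 / 50 : ℝ) ≤ dist v u) →
    (∀ (X : Finset (EuclideanSpace ℝ (Fin 3))) (e : EuclideanSpace ℝ (Fin 3)), X.card = 12 →
      (∀ y ∈ X, ‖y‖ = 1) → (∀ y ∈ X, ∀ y' ∈ X, y ≠ y' → inner ℝ y y' ≤ (1 / 2 : ℝ)) → e ∈ X →
      (∀ y ∈ X, y ≠ e → inner ℝ y e = (1 / 2 : ℝ) ∨ inner ℝ y e ≤ (1031 / 5000 : ℝ)) →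
      3 ≤ (X.filter fun y => inner ℝ y e = (1 / 2 : ℝ)).card) →
    (∀ Z : Set (EuclideanSpace ℝ (Fin 3)), (∀ x ∈ Z, ∀ y ∈ Z, x ≠ y → 1 ≤ dist x y) →
      ∀ z ∈ Z, ∀ z' ∈ Z, dist z z' = 1 →
        {w ∈ Z | dist w z = 1}.ncard = 12 → {w ∈ Z | dist w z' = 1}.ncard = 12 →
        (∀ w ∈ Z, w ≠ z → dist w z = 1 ∨ (63 / 50 : ℝ) ≤ dist w z) →
        (∀ w ∈ Z, w ≠ z' → dist w z' = 1 ∨ (63 / 50 : ℝ) ≤ dist w z') →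
        {w ∈ Z | dist w z = 1 ∧ dist w z' = 1}.ncard ≠ 3) →
    ∀ Z : Set (EuclideanSpace ℝ (Fin 3)), (∀ x ∈ Z, ∀ y ∈ Z, x ≠ y → 1 ≤ dist x y) →
      ∀ z ∈ Z, ∀ z' ∈ Z, dist z z' = 1 → {w ∈ Z | dist w z = 1}.ncard = 12 →
        {w ∈ Z | dist w z' = 1}.ncard = 12 → 4 ≤ {w ∈ Z | dist w z = 1 ∧ dist w z' = 1}.ncard := by
  intro hgap hpolar hno3 Z hZ z hz z' hz' hzz' hNz hNz'
  -- the two gap dichotomies, from the gap stub at `z` and at `z'`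
  have hGz : ∀ w ∈ Z, w ≠ z → dist w z = 1 ∨ (63 / 50 : ℝ) ≤ dist w z := by
    intro w hw hne
    by_cases h : dist w z = 1
    · exact Or.inl h
    · exact Or.inr (hgap Z hZ z hz hNz w hw hne h)
  have hGz' : ∀ w ∈ Z, w ≠ z' → dist w z' = 1 ∨ (63 / 50 : ℝ) ≤ dist w z' := by
    intro w hw hne
    by_cases h : dist w z' = 1
    · exact Or.inl h
    · exact Or.inr (hgap Z hZ z' hz' hNz' w hw hne h)
  -- `c ≠ 3` (coupled core) and `3 ≤ c` (one-sphere reduction)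
  have h3 : {w ∈ Z | dist w z = 1 ∧ dist w z' = 1}.ncard ≠ 3 :=
    hno3 Z hZ z hz z' hz' hzz' hNz hNz' hGz hGz'
  have hge : 3 ≤ {w ∈ Z | dist w z = 1 ∧ dist w z' = 1}.ncard :=
    three_le_ncard_common hpolar hZ hz' hzz' hNz hGz'
  omega

/-- The hypothesis form concludes the route's crux decl itself (by `rfl`-unfolding): the shape
`⟨stub_twelveKissedGap⟩ → ⟨stub_polarThree⟩ → ⟨stub_noThreeCommon⟩ → TwoCentreFourCommon`, sorry-free. -/
example :
    (∀ Z : Set (EuclideanSpace ℝ (Fin 3)), (∀ x ∈ Z, ∀ y ∈ Z, x ≠ y → 1 ≤ dist x y) →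
      ∀ u ∈ Z, {w ∈ Z | dist w u = 1}.ncard = 12 →
        ∀ v ∈ Z, v ≠ u → dist v u ≠ 1 → (63 / 50 : ℝ) ≤ dist v u) →
    (∀ (X : Finset (EuclideanSpace ℝ (Fin 3))) (e : EuclideanSpace ℝ (Fin 3)), X.card = 12 →
      (∀ y ∈ X, ‖y‖ = 1) → (∀ y ∈ X, ∀ y' ∈ X, y ≠ y' → inner ℝ y y' ≤ (1 / 2 : ℝ)) → e ∈ X →
      (∀ y ∈ X, y ≠ e → inner ℝ y e = (1 / 2 : ℝ) ∨ inner ℝ y e ≤ (1031 / 5000 : ℝ)) →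
      3 ≤ (X.filter fun y => inner ℝ y e = (1 / 2 : ℝ)).card) →
    (∀ Z : Set (EuclideanSpace ℝ (Fin 3)), (∀ x ∈ Z, ∀ y ∈ Z, x ≠ y → 1 ≤ dist x y) →
      ∀ z ∈ Z, ∀ z' ∈ Z, dist z z' = 1 →
        {w ∈ Z | dist w z = 1}.ncard = 12 → {w ∈ Z | dist w z' = 1}.ncard = 12 →
        (∀ w ∈ Z, w ≠ z → dist w z = 1 ∨ (63 / 50 : ℝ) ≤ dist w z) →
        (∀ w ∈ Z, w ≠ z' → dist w z' = 1 ∨ (63 / 50 : ℝ) ≤ dist w z') →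
        {w ∈ Z | dist w z = 1 ∧ dist w z' = 1}.ncard ≠ 3) →
    TwoCentreFourCommon :=
  TwoCentreFourCommon_of_stubs

/-! ## The registered skeleton theorem: the crux BY NAME from the declared stubs BY NAME -/

/-- **THE SKELETON.**  The crux `TwoCentreKissingKernel.TwoCentreFourCommon` from the three declared
stubs `stub_twelveKissedGap`, `stub_polarThree`, `stub_noThreeCommon` through the sorry-free
assembly `TwoCentreFourCommon_of_stubs`; `sorry` enters only through the stubs. -/
theorem TwoCentreFourCommon_of : TwoCentreFourCommon :=
  TwoCentreFourCommon_of_stubs stub_twelveKissedGap stub_polarThree stub_noThreeCommon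

end Summit.AtomisticToContinuum.Crystallization.Cruxes.TwoCentreFourCommon.Birth

end
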